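import Mathlib
import Literature.Analysis.ODE.LinearComparison
import Summits.NavierStokesRegularity.NavierStokesRegularity.Theorems.SubOnsagerCeilingDyadicRangeChain
import Summits.NavierStokesRegularity.NavierStokesRegularity.Theorems.SubOnsagerCeilingDyadicMidRangeRegion
import Summits.NavierStokesRegularity.NavierStokesRegularity.Theorems.SubOnsagerCeilingDyadicMidRangeHoldsTB
import Summits.NavierStokesRegularity.NavierStokesRegularity.Theorems.SubOnsagerCeilingDyadicMidRangeHoldsC
import HarnessLib

/-!
# The ν-uniform shell barrier for the positive viscous Katz–Pavlović chain at every scale ratio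
# `b ∈ [81/50, 43/25]` (helper file for crux stmt-NavierStokesRegularity-27057, `--supports`)

**What is proved (`chain_shellBarrier_midRange`).** Let `b ∈ [81/50, 43/25]`, `c₀ > 0`, `ν > 0`, and
let `Z_k : [0, s] → ℝ` (`k ≥ -1`, `Z_{-1} ≡ 0`) be an honest solution of the NS-scaled viscous chain
`Ż_k = c₀(b^{5(k-1)/2} Z²_{k-1} − b^{5k/2} Z_k Z_{k+1}) − ν b^{2k} Z_k` on `[0, s]` from the one-shell
datum `Z_k(0) = x₀·1_{k=0}`, continuous, non-negative on the shells `k ≥ 1`, with Tao's weight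
bound `(1 + b^{10k})|Z_k(t)| ≤ M`. Then for all `t ∈ [0, s]` and `k ≥ 0`

  `b^{2θk} Z_k(t)² ≤ 100 · x₀²`,  `θ = 101/200 > 1/2`,

uniformly in `ν`, `c₀`, `s` and the datum. The sibling `SubOnsagerCeilingDyadicRangeChain` proves
this for `b ∈ [17/10, 2]` with the two-window Barbato–Morandin–Romito region; here the range
`b ∈ [1.62, 1.72]` is obtained from the THREE-WINDOW region
`DyadicMidRange.invariantRegionCut_le_one_of_tail` (one extra linear cut
`(43/100)Yₙ − (19/20)Y_{n+1} + Y_{n+2} ≤ 27/40`), whose inward-pointing facts are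
`hT_holds`, `hB_holds`, `hC_holds`, `hC0_holds`. Below `b ≈ 1.6` no two-window BMR-type region
exists (LEAD census of crux 27057); the third window is what buys `[1.62, 1.7)`.

**Proof.** Rescale `Y_{k+1} = A b^{θk} σ_k Z_k` exactly as in the sibling file (`A = δ/(|x₀| + η)`):
`F_{k+1} = (c₀/A) b^{2θ-5/2} L^k`, `L = b^{5/2-θ}`, `p = b^{5/2-3θ} = b^{197/200} ∈ [8/5, 171/100]`,
`L/p² = b^{1/40} ∈ [253/250, 507/500]`, lower-curve constant `c = (26/25)/p` (`pc = 26/25 ≥ 1`),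
`κ_{k+1} = νb^{2k}` (ratio `b² ≤ 4`); the tail is quiescent by the weight bound, the datum shell keeps
its sign, and the region lemma gives `Y ≤ 1`.

HONEST FRAMING: MODEL lattice ODE statement (rung under crux `ForwardTailCeilingKP` of route
SubOnsagerCeiling, TL-M2Break, one-mode chain class, ratios `ε₀ ∈ [0.62, 0.72]`); nothing here bears
on Navier–Stokes regularity and no crux or summit is proved.
[cite: BarbatoMorandinRomito2011, §2 Lemma 2.1, §3.2 proof of Thm. 1] [cite: Tao2016AveragedNS, §4 (4.5), (4.13)]
-/

noncomputable section

-- the sub-problem namespace `NavierStokesRegularity.NavierStokesRegularity` is the tree's layout (D-0017)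
set_option linter.dupNamespace false

namespace Summit.NavierStokesRegularity.NavierStokesRegularity.Theorems.DyadicMidRange

open Set Filter Topology
open Summit.NavierStokesRegularity.NavierStokesRegularity.Theorems.DyadicRange

/-! ## Numerical facts about the scale ratio -/

/-- `(81/50)^{197/200} ≥ 8/5` (since `(8/5)^{200} ≤ (81/50)^{197}`). [folklore] -/
theorem rpow_p_lo : (8 / 5 : ℝ) ≤ (81 / 50 : ℝ) ^ ((197 : ℝ) / 200) := by
  have h0 : (0 : ℝ) ≤ (81 / 50 : ℝ) ^ ((197 : ℝ) / 200) := by positivity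
  have h2 : ((81 / 50 : ℝ) ^ ((197 : ℝ) / 200)) ^ (200 : ℕ) = (81 / 50 : ℝ) ^ (197 : ℕ) := by
    rw [← Real.rpow_natCast, ← Real.rpow_mul (by norm_num)]
    norm_num
  by_contra h
  push Not at h
  have h3 : ((81 / 50 : ℝ) ^ ((197 : ℝ) / 200)) ^ (200 : ℕ) < (8 / 5 : ℝ) ^ (200 : ℕ) :=
    pow_lt_pow_left₀ h h0 (by norm_num)
  rw [h2] at h3
  norm_num at h3

/-- `(43/25)^{197/200} ≤ 171/100` (since `(43/25)^{197} ≤ (171/100)^{200}`). [folklore] -/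
theorem rpow_p_hi : (43 / 25 : ℝ) ^ ((197 : ℝ) / 200) ≤ 171 / 100 := by
  have h0 : (0 : ℝ) ≤ (43 / 25 : ℝ) ^ ((197 : ℝ) / 200) := by positivity
  have h2 : ((43 / 25 : ℝ) ^ ((197 : ℝ) / 200)) ^ (200 : ℕ) = (43 / 25 : ℝ) ^ (197 : ℕ) := by
    rw [← Real.rpow_natCast, ← Real.rpow_mul (by norm_num)]
    norm_num
  by_contra h
  push Not at h
  have h3 : (171 / 100 : ℝ) ^ (200 : ℕ) < ((43 / 25 : ℝ) ^ ((197 : ℝ) / 200)) ^ (200 : ℕ) :=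
    pow_lt_pow_left₀ h (by norm_num) (by norm_num)
  rw [h2] at h3
  norm_num at h3

/-- `(81/50)^{1/40} ≥ 253/250` (since `(253/250)^{40} ≤ 81/50`). [folklore] -/
theorem rpow_l_lo : (253 / 250 : ℝ) ≤ (81 / 50 : ℝ) ^ ((1 : ℝ) / 40) := by
  have h0 : (0 : ℝ) ≤ (81 / 50 : ℝ) ^ ((1 : ℝ) / 40) := by positivity
  have h2 : ((81 / 50 : ℝ) ^ ((1 : ℝ) / 40)) ^ (40 : ℕ) = (81 / 50 : ℝ) := by
    rw [← Real.rpow_natCast, ← Real.rpow_mul (by norm_num)]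
    norm_num
  by_contra h
  push Not at h
  have h3 : ((81 / 50 : ℝ) ^ ((1 : ℝ) / 40)) ^ (40 : ℕ) < (253 / 250 : ℝ) ^ (40 : ℕ) :=
    pow_lt_pow_left₀ h h0 (by norm_num)
  rw [h2] at h3
  norm_num at h3

/-- `(43/25)^{1/40} ≤ 507/500` (since `43/25 ≤ (507/500)^{40}`). [folklore] -/
theorem rpow_l_hi : (43 / 25 : ℝ) ^ ((1 : ℝ) / 40) ≤ 507 / 500 := by
  have h0 : (0 : ℝ) ≤ (43 / 25 : ℝ) ^ ((1 : ℝ) / 40) := by positivity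
  have h2 : ((43 / 25 : ℝ) ^ ((1 : ℝ) / 40)) ^ (40 : ℕ) = (43 / 25 : ℝ) := by
    rw [← Real.rpow_natCast, ← Real.rpow_mul (by norm_num)]
    norm_num
  by_contra h
  push Not at h
  have h3 : (507 / 500 : ℝ) ^ (40 : ℕ) < ((43 / 25 : ℝ) ^ ((1 : ℝ) / 40)) ^ (40 : ℕ) :=
    pow_lt_pow_left₀ h (by norm_num) (by norm_num)
  rw [h2] at h3
  norm_num at h3

/-- The rescaling constants at ratio `b ∈ [81/50, 43/25]`: `p = b^{5/2}/b^{3θ} ∈ [8/5, 171/100]` and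
`L = b^{5/2}/b^{θ}` with `(253/250)p² ≤ L ≤ (507/500)p²` (`θ = 101/200`). [folklore] -/
theorem ratio_consts_mid {b : ℝ} (hb : 81 / 50 ≤ b) (hb2 : b ≤ 43 / 25) :
    8 / 5 ≤ b ^ ((5 : ℝ) / 2) / (b ^ ((101 : ℝ) / 200)) ^ 3 ∧
      b ^ ((5 : ℝ) / 2) / (b ^ ((101 : ℝ) / 200)) ^ 3 ≤ 171 / 100 ∧
      (253 : ℝ) / 250 * (b ^ ((5 : ℝ) / 2) / (b ^ ((101 : ℝ) / 200)) ^ 3) ^ 2 ≤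
          b ^ ((5 : ℝ) / 2) / b ^ ((101 : ℝ) / 200) ∧
      b ^ ((5 : ℝ) / 2) / b ^ ((101 : ℝ) / 200) ≤
          (507 : ℝ) / 500 * (b ^ ((5 : ℝ) / 2) / (b ^ ((101 : ℝ) / 200)) ^ 3) ^ 2 := by
  have hb0 : 0 < b := by linarith
  have hp_eq : b ^ ((5 : ℝ) / 2) / (b ^ ((101 : ℝ) / 200)) ^ 3 = b ^ ((197 : ℝ) / 200) := by
    rw [← Real.rpow_natCast, ← Real.rpow_mul hb0.le, ← Real.rpow_sub hb0]
    norm_num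
  have hL_eq : b ^ ((5 : ℝ) / 2) / b ^ ((101 : ℝ) / 200) = b ^ ((399 : ℝ) / 200) := by
    rw [← Real.rpow_sub hb0]; norm_num
  have hp2 : (b ^ ((197 : ℝ) / 200)) ^ 2 = b ^ ((197 : ℝ) / 100) := by
    rw [← Real.rpow_natCast, ← Real.rpow_mul hb0.le]; norm_num
  have hsplit : b ^ ((399 : ℝ) / 200) = b ^ ((1 : ℝ) / 40) * b ^ ((197 : ℝ) / 100) := by
    rw [← Real.rpow_add hb0]; norm_num
  have hlo : (253 : ℝ) / 250 ≤ b ^ ((1 : ℝ) / 40) :=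
    rpow_l_lo.trans (Real.rpow_le_rpow (by norm_num) hb (by norm_num))
  have hhi : b ^ ((1 : ℝ) / 40) ≤ 507 / 500 :=
    (Real.rpow_le_rpow hb0.le hb2 (by norm_num)).trans rpow_l_hi
  have hpos : 0 ≤ b ^ ((197 : ℝ) / 100) := Real.rpow_nonneg hb0.le _
  rw [hp_eq, hL_eq, hp2, hsplit]
  refine ⟨rpow_p_lo.trans (Real.rpow_le_rpow (by norm_num) hb (by norm_num)),
    (Real.rpow_le_rpow hb0.le hb2 (by norm_num)).trans rpow_p_hi,
    mul_le_mul_of_nonneg_right hlo hpos, ?_⟩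
  exact mul_le_mul_of_nonneg_right hhi hpos

/-! ## The chain barrier -/

/-- **The ν-uniform shell barrier for the positive viscous Katz–Pavlović chain at scale ratio
`b ∈ [81/50, 43/25]`** (see the module docstring): `b^{2θk}Z_k(t)² ≤ 100·x₀²`, `θ = 101/200`, along
every honest solution on `[0, s]` from the one-shell datum `x₀`, for every viscosity `ν > 0` and
coupling `c₀ > 0`. [cite: BarbatoMorandinRomito2011, §2 Lemma 2.1 and §3.2] -/
theorem chain_shellBarrier_midRange {b c₀ ν s x₀ : ℝ} (hb : 81 / 50 ≤ b) (hb2 : b ≤ 43 / 25) (hc₀ : 0 < c₀)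
    (hν : 0 < ν) (hs : 0 < s) {Z : ℤ → ℝ → ℝ}
    (hdat : ∀ k : ℤ, Z k 0 = if k = 0 then x₀ else 0)
    (hvan : ∀ t, Z (-1) t = 0)
    (hbdd : ∃ M : ℝ, ∀ (t : ℝ) (k : ℕ), (1 + b ^ ((10 : ℝ) * k)) * |Z k t| ≤ M)
    (hcont : ∀ k : ℕ, ContinuousOn (Z k) (Icc 0 s))
    (hode : ∀ k : ℕ, ∀ t ∈ Icc 0 s, HasDerivWithinAt (Z k)
      (c₀ * (b ^ ((5 : ℝ) * ((k : ℝ) - 1) / 2) * Z ((k : ℤ) - 1) t ^ 2 -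
          b ^ ((5 : ℝ) * (k : ℝ) / 2) * (Z k t * Z ((k : ℤ) + 1) t)) -
        ν * b ^ ((2 : ℝ) * (k : ℝ)) * Z k t) (Icc 0 s) t)
    (hnn : ∀ t ∈ Icc 0 s, ∀ k : ℕ, 1 ≤ k → 0 ≤ Z k t) :
    ∀ t ∈ Icc 0 s, ∀ k : ℕ, (b ^ ((101 : ℝ) / 200)) ^ (2 * k) * Z k t ^ 2 ≤ 100 * x₀ ^ 2 := by
  intro t ht k
  have hb0 : 0 < b := by linarith
  have hb1 : 1 ≤ b := by linarith
  -- the constants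
  set B₁ : ℝ := b ^ ((101 : ℝ) / 200) with hB₁
  set B₅ : ℝ := b ^ ((5 : ℝ) / 2) with hB₅
  have hB₁0 : 0 < B₁ := Real.rpow_pos_of_pos hb0 _
  have hB₅0 : 0 < B₅ := Real.rpow_pos_of_pos hb0 _
  set L : ℝ := B₅ / B₁ with hL
  set p : ℝ := B₅ / B₁ ^ 3 with hp
  have hL0 : 0 < L := div_pos hB₅0 hB₁0
  have hp0 : 0 < p := div_pos hB₅0 (pow_pos hB₁0 3)
  -- `p = b^{197/200} ∈ [8/5, 171/100]`, `(253/250)p² ≤ L ≤ (507/500)p²`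
  obtain ⟨hp_lo, hp_hi, hL_lo, hL_hi⟩ := ratio_consts_mid hb hb2
  have hpL : p ^ 2 ≤ L := le_trans (by linarith [sq_nonneg p] : p ^ 2 ≤ (253 : ℝ) / 250 * p ^ 2) hL_lo
  set c : ℝ := 26 / 25 / p with hc
  have hpc : p * c = 26 / 25 := by rw [hc]; field_simp
  have hpc1 : (1 : ℝ) ≤ p * c := by rw [hpc]; norm_num
  have hc0 : 0 ≤ c := by rw [hc]; positivity
  -- powers of `b` along the shells
  have hΛ : ∀ k : ℕ, b ^ ((5 : ℝ) * (k : ℝ) / 2) = B₅ ^ k := by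
    intro k
    rw [hB₅, ← Real.rpow_mul_natCast hb0.le]; congr 1; ring
  have hΛ' : ∀ k : ℕ, b ^ ((5 : ℝ) * ((k : ℝ) - 1) / 2) = B₅ ^ k / B₅ := by
    intro k
    rw [show (5 : ℝ) * ((k : ℝ) - 1) / 2 = (5 : ℝ) * (k : ℝ) / 2 - 5 / 2 by ring, Real.rpow_sub hb0,
      hΛ k]
  have h2k : ∀ k : ℕ, b ^ ((2 : ℝ) * (k : ℝ)) = (b ^ 2) ^ k := by
    intro k
    rw [Real.rpow_mul_natCast hb0.le, Real.rpow_two]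
  -- the sign of the datum shell
  set σ : ℝ := if 0 ≤ x₀ then 1 else -1 with hσ
  have hσ2 : σ ^ 2 = 1 := by rw [hσ]; split_ifs <;> norm_num
  have hσa : σ * x₀ = |x₀| := by
    rw [hσ]; split_ifs with h
    · rw [abs_of_nonneg h, one_mul]
    · rw [abs_of_neg (not_le.1 h)]; ring
  -- the datum shell keeps its sign on `[0, s]`: `g = σ Z₀` solves `ġ = -(c₀ Z₁ + ν) g`
  have hg_nonneg : ∀ τ ∈ Icc 0 s, 0 ≤ σ * Z 0 τ := by
    have hode0 : ∀ r ∈ Ico 0 s, HasDerivWithinAt (fun r => σ * Z 0 r)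
        (0 + (-(c₀ * Z 1 r + ν)) * (σ * Z 0 r)) (Ici r) r := by
      intro r hr
      have h := hode 0 r (Ico_subset_Icc_self hr)
      have e1 : ((0 : ℕ) : ℤ) - 1 = -1 := by norm_num
      have e2 : ((0 : ℕ) : ℤ) + 1 = 1 := by norm_num
      rw [e1, e2, hvan r] at h
      have h' := (h.mono_of_mem_nhdsWithin (Icc_mem_nhdsGE_of_mem hr)).const_mul σ
      refine h'.congr_deriv ?_
      have e3 : b ^ ((5 : ℝ) * ((0 : ℕ) : ℝ) / 2) = 1 := by simp
      have e4 : b ^ ((2 : ℝ) * ((0 : ℕ) : ℝ)) = 1 := by simp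
      rw [e3, e4]
      ring
    have hcg : ContinuousOn (fun r => σ * Z 0 r) (Icc 0 s) := continuousOn_const.mul (hcont 0)
    have h00 : 0 ≤ σ * Z 0 0 := by rw [hdat 0, if_pos rfl, hσa]; exact abs_nonneg _
    exact datum_sign_nonneg hcg (hcont 1) hode0 h00
  -- the weight bound
  obtain ⟨M, hM⟩ := hbdd
  have hM0 : 0 ≤ M := le_trans (mul_nonneg (by positivity) (abs_nonneg _)) (hM 0 0)
  -- the bound for every `η > 0`
  suffices main : ∀ η : ℝ, 0 < η → B₁ ^ (2 * k) * Z k t ^ 2 ≤ 100 * (|x₀| + η) ^ 2 by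
    have hlim : Tendsto (fun η : ℝ => 100 * (|x₀| + η) ^ 2) (𝓝[>] 0) (𝓝 (100 * (|x₀| + 0) ^ 2)) :=
      ((tendsto_nhdsWithin_of_tendsto_nhds (f := fun η : ℝ => 100 * (|x₀| + η) ^ 2)
        (Continuous.tendsto (by continuity) 0)))
    rw [add_zero, sq_abs] at hlim
    exact ge_of_tendsto hlim (eventually_nhdsWithin_of_forall fun η hη => main η hη)
  intro η hη
  have hxη : 0 < |x₀| + η := by positivity
  set A : ℝ := 1 / 10 / (|x₀| + η) with hA
  have hA0 : 0 < A := by positivity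
  -- the rescaled chain
  set sg : ℕ → ℝ := fun k => if k = 0 then σ else 1 with hsg
  have hsg2 : ∀ k, sg k ^ 2 = 1 := by intro k; rw [hsg]; dsimp only; split_ifs; exact hσ2; norm_num
  set Y : ℕ → ℝ → ℝ := fun n τ =>
    if n = 0 then 0 else A * B₁ ^ (n - 1) * (sg (n - 1) * Z ((n - 1 : ℕ) : ℤ) τ) with hY
  have hY0 : ∀ τ, Y 0 τ = 0 := fun τ => by simp [hY]
  have hYs : ∀ (k : ℕ) (τ : ℝ), Y (k + 1) τ = A * B₁ ^ k * (sg k * Z k τ) := by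
    intro k τ; simp [hY]
  have hY1 : ∀ τ, Y 1 τ = A * (σ * Z 0 τ) := fun τ => by
    rw [show (1 : ℕ) = 0 + 1 from rfl, hYs]; simp [hsg]
  have hY2 : ∀ (j : ℕ) (τ : ℝ), Y (j + 2) τ = A * B₁ ^ (j + 1) * Z ((j + 1 : ℕ) : ℤ) τ := by
    intro j τ; rw [show j + 2 = (j + 1) + 1 from rfl, hYs]; simp [hsg]
  set b2 : ℝ := b ^ 2 with hb2def
  have hb20 : 0 < b2 := by rw [hb2def]; positivity
  have hb21 : 1 ≤ b2 := by rw [hb2def]; exact one_le_pow₀ hb1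
  have hb24 : b2 ≤ 4 := by rw [hb2def]; nlinarith
  set G : ℝ := c₀ / A * (B₁ ^ 2 / B₅) with hG
  have hG0 : 0 < G := by rw [hG]; positivity
  set κ : ℕ → ℝ := fun n => ν * b2 ^ n / b2 with hκ
  set F : ℕ → ℝ := fun n => G * L ^ n / L with hF
  obtain ⟨hκpos, hκmono, hκ4, hκs0⟩ :
      (∀ n, 0 < κ n) ∧ (∀ n, κ n ≤ κ (n + 1)) ∧ (∀ n, κ (n + 1) ≤ 4 * κ n) ∧
        (∀ k : ℕ, κ (k + 1) = ν * b2 ^ k) := kappa_facts hν hb20 hb21 hb24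
  obtain ⟨hFpos, hFL, hFs0⟩ :
      (∀ n, 0 < F n) ∧ (∀ n, F (n + 1) = L * F n) ∧ (∀ k : ℕ, F (k + 1) = G * L ^ k) :=
    prod_facts hG0 hL0
  have hκs : ∀ k : ℕ, κ (k + 1) = ν * b2 ^ k := hκs0
  have hFs : ∀ k : ℕ, F (k + 1) = G * L ^ k := hFs0
  -- continuity, positivity, datum
  have hYcont : ∀ n, ContinuousOn (Y n) (Icc 0 s) := by
    intro n
    rcases n with _ | k
    · have : Y 0 = fun _ => 0 := funext hY0
      rw [this]; exact continuousOn_const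
    · have : Y (k + 1) = fun τ => A * B₁ ^ k * (sg k * Z k τ) := funext (hYs k)
      rw [this]
      exact continuousOn_const.mul (continuousOn_const.mul (hcont k))
  have hYpos : ∀ n, ∀ τ ∈ Icc 0 s, 0 ≤ Y n τ := by
    intro n τ hτ
    rcases n with _ | k
    · rw [hY0]
    rcases k with _ | j
    · rw [hY1]; exact mul_nonneg hA0.le (hg_nonneg τ hτ)
    · rw [hY2]; exact mul_nonneg (by positivity) (hnn τ hτ (j + 1) (by omega))
  have hYinit : ∀ n, Y n 0 ≤ 1 / 10 := by
    intro n
    rcases n with _ | k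
    · rw [hY0]; norm_num
    rcases k with _ | j
    · have hAx : A * |x₀| ≤ 1 / 10 := by
        rw [hA, div_mul_eq_mul_div, div_le_iff₀ hxη]
        linarith [abs_nonneg x₀]
      rw [hY1, hdat 0, if_pos rfl, hσa]; exact hAx
    · have hne : (((j + 1 : ℕ) : ℤ)) ≠ 0 := Int.natCast_ne_zero.mpr (Nat.succ_ne_zero j)
      rw [hY2, hdat, if_neg hne, mul_zero]; norm_num
  -- the quiescent tail (Tao's weight bound (4.5))
  have hbt : 0 < b ^ (10 : ℝ) := Real.rpow_pos_of_pos hb0 _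
  set q : ℝ := B₁ / b ^ (10 : ℝ) with hq
  have hq0 : 0 ≤ q := by rw [hq]; positivity
  have hq1 : q < 1 := by
    rw [hq, div_lt_one hbt, hB₁]
    exact Real.rpow_lt_rpow_of_exponent_lt (by linarith) (by norm_num)
  have hZle : ∀ (k : ℕ) (τ : ℝ), (b ^ (10 : ℝ)) ^ k * |Z k τ| ≤ M := by
    intro k τ
    have h := hM τ k
    rw [Real.rpow_mul_natCast hb0.le] at h
    have h0 : 0 ≤ |Z k τ| := abs_nonneg _
    have h1 : (1 + (b ^ (10 : ℝ)) ^ k) * |Z k τ| = |Z k τ| + (b ^ (10 : ℝ)) ^ k * |Z k τ| := by ring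
    linarith
  have hYle' : ∀ (k : ℕ) (τ : ℝ), Y (k + 1) τ ≤ A * M * q ^ k := by
    intro k τ
    rw [hYs]
    have hs : |sg k| = 1 := by
      rw [hsg]; dsimp only; split_ifs
      · rw [hσ]; split_ifs <;> norm_num
      · norm_num
    have h1 : sg k * Z k τ ≤ |Z k τ| := by
      have := le_abs_self (sg k * Z k τ)
      rwa [abs_mul, hs, one_mul] at this
    have h2 : B₁ ^ k * |Z k τ| = q ^ k * ((b ^ (10 : ℝ)) ^ k * |Z k τ|) := by
      rw [hq, div_pow]; field_simp
    have h3 : q ^ k * ((b ^ (10 : ℝ)) ^ k * |Z k τ|) ≤ q ^ k * M :=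
      mul_le_mul_of_nonneg_left (hZle k τ) (pow_nonneg hq0 k)
    calc A * B₁ ^ k * (sg k * Z k τ) ≤ A * B₁ ^ k * |Z k τ| :=
          mul_le_mul_of_nonneg_left h1 (by positivity)
      _ = A * (B₁ ^ k * |Z k τ|) := by ring
      _ = A * (q ^ k * ((b ^ (10 : ℝ)) ^ k * |Z k τ|)) := by rw [h2]
      _ ≤ A * (q ^ k * M) := mul_le_mul_of_nonneg_left h3 hA0.le
      _ = A * M * q ^ k := by ring
  obtain ⟨K, hK⟩ := geometric_tail_small hq0 hq1 (show 0 ≤ A * M by positivity)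
  have hYtail : ∀ n, K + 1 ≤ n → ∀ τ ∈ Icc 0 s, Y n τ ≤ 1 / 10 := by
    intro n hn τ _
    obtain ⟨k, rfl⟩ : ∃ k, n = k + 1 := ⟨n - 1, by omega⟩
    exact (hYle' k τ).trans (hK k (by omega))
  -- the equations of motion of the rescaled chain
  have hYderiv : ∀ n, 1 ≤ n → ∀ τ ∈ Ico 0 s, HasDerivWithinAt (Y n)
      (-κ n * Y n τ + F n * (Y (n - 1) τ ^ 2 - p * Y n τ * Y (n + 1) τ)) (Ici τ) τ := by
    intro n hn τ hτ
    obtain ⟨k, rfl⟩ : ∃ k, n = k + 1 := ⟨n - 1, by omega⟩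
    have h := hode k τ (Ico_subset_Icc_self hτ)
    rw [hΛ' k, hΛ k, h2k k] at h
    have h' := (h.mono_of_mem_nhdsWithin (Icc_mem_nhdsGE_of_mem hτ)).const_mul (A * B₁ ^ k * sg k)
    have hfun : Y (k + 1) = fun r => A * B₁ ^ k * sg k * Z k r := by
      funext r; rw [hYs]; ring
    rw [hfun]
    refine h'.congr_deriv ?_
    simp only [Nat.add_sub_cancel]
    rw [hκs k, hFs k, show k + 1 + 1 = k + 2 from rfl, hY2 k]
    have ek : ((k : ℕ) : ℤ) + 1 = (((k + 1 : ℕ)) : ℤ) := by push_cast; ring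
    rw [ek]
    rcases k with _ | j
    · -- the datum shell: no feed (`Z_{-1} = 0`, `Y_0 = 0`)
      have e1 : ((0 : ℕ) : ℤ) - 1 = -1 := by norm_num
      rw [e1, hvan τ, hY0, hG, hL, hp]
      linear_combination rescale_identity_zero A B₁ B₅ c₀ ν (sg 0) (Z 0 τ) (Z ((0 + 1 : ℕ) : ℤ) τ)
        hA0.ne' hB₁0.ne' hB₅0.ne'
    · have e1 : (((j + 1 : ℕ)) : ℤ) - 1 = ((j : ℕ) : ℤ) := by push_cast; ring
      have es1 : sg (j + 1) = 1 := by simp [hsg]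
      rw [e1, hYs j, es1, hG, hL, hp]
      linear_combination rescale_identity_succ A B₁ B₅ c₀ ν b2 (sg j) (Z j τ)
        (Z ((j + 1 : ℕ) : ℤ) τ) (Z ((j + 1 + 1 : ℕ) : ℤ) τ) j hA0.ne' hB₁0.ne' hB₅0.ne' (hsg2 j)
  -- the region lemma: `Y ≤ 1`
  have hYle : ∀ n, ∀ τ ∈ Icc 0 s, Y n τ ≤ 1 :=
    invariantRegionCut_le_one_of_tail (θ₀ := 5 / 8) (m₁ := 69 / 100) (m₂ := -(7 / 40)) (a := 43 / 100)
      (b₁ := 19 / 20) (d := 27 / 40) hs hκpos hκmono hκ4 hFpos hFL hc0 hpc1 hp0.le (by norm_num)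
      (fun x _ hx1 => by linarith) (by norm_num) (by norm_num) (by norm_num)
      (fun x y hx0 hx1 hy0 hy => hC0_holds x y hx0 hx1 hy0 hy)
      (fun κ0 κ1 Fn x w z h1 h2 h3 h4 h5 h6 h7 h8 h9 h10 h11 =>
        hT_holds hp_lo hp_hi hpc hpL h1 h2 h3 h4 h5 h6 h7 h8 h9 h10 h11)
      (fun κ0 κ1 Fn x y z w h1 h2 h3 h4 h5 h6 h7 h8 h9 h10 h11 h12 =>
        hB_holds hp_lo hp_hi hpc hpL h1 h2 h3 h4 h5 h6 h7 h8 h9 h10 h11 h12)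
      (fun κ0 κ1 κ2 Fn w x y z v h1 h2 h3 h4 h5 h6 h7 h8 h9 h10 h11 h12 h13 h14 h15 h16 h17 h18 h19 h20 h21
          h22 h23 h24 =>
        hC_holds hp_lo hp_hi hpc hL_lo hL_hi h1 h2 h3 h4 h5 h6 h7 h8 h9 h10 h11 h12 h13 h14 h15 h16 h17
          h18 h19 h20 h21 h22 h23 h24)
      hY0 hYcont hYderiv hYpos hYinit hYtail
  -- conclusion at the shell `k`
  exact unscale_bound hxη hA (hYs k t) (hsg2 k) (hYpos (k + 1) t ht) (hYle (k + 1) t ht)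

end Summit.NavierStokesRegularity.NavierStokesRegularity.Theorems.DyadicMidRange

end
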